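import Summits.ValiantsHypothesis.ValiantsHypothesis.Theses.SymmetroidDescartes
import Summits.ValiantsHypothesis.ValiantsHypothesis.Theorems.DerivedPencilRolle.Negative.DerivedPencilRolleUniformStep
import Summits.ValiantsHypothesis.ValiantsHypothesis.Theorems.SymmetroidDescartesRolleToDescartes

/-!
# Disproof of `DerivedPencilRolle` (crux stmt-ValiantsHypothesis-18500, route SymmetroidDescartes) — findings

Seat `refuter-cdisprove-stmt-ValiantsHypothesis-18500-0`, cycle 1 (2026-08-17).  Crux S:
`∃ C a, ∀ m K S d (symmetric, invertible, d strictly increasing), Z₊(det F) ≤ C·Z₊(det ∂F) + (m+K)^a`.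

**VERDICT (paper): S IS FALSE.**  Lean status: `¬S` is landed MODULO the construction `TriangularClassManyRoots`
(§B; negative lemma `derivedPencilRolle_false_of_triangularClassManyRoots`, proposal p145878
`Theorems/DerivedPencilRolle/Negative/DerivedPencilRolleFalseOfTriangularClassManyRoots.lean`), and the construction
is proved on paper below (§B docstring) from a published theorem (parametric shortest paths have `n^{Ω(log n)}`
breakpoints: Carstensen 1983; Mulmuley–Shah 2001; Gajjar–Radhakrishnan arXiv:1811.05115 Thm 1/Lemma 7) plus an
elementary convexity-bump realisation (new here), checked numerically by kit job j023449.

## Index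
* §A  THE ROLLE TERM IS DECORATIVE ON A UNIVERSAL CLASS (sorry-free).  For `P(t) = Σ_l t^{d_l} T_l` with `T_0`
  invertible and `T_l` (`l ≥ 1`) upper triangular with positive diagonal ("triangular class"), the symmetrisation
  `S_0 = [[0,T_0],[T_0ᵀ,1]]`, `S_l = [[0,T_l],[T_lᵀ,0]]` is a legal crux instance (`m = 2k`) with
  `det F(t) = (−1)^k det P(t)²` and `det ∂F(t) ≠ 0` for all `t > 0`.  Hence (`triangular_bound_of_pencilBound`)
  `PencilBound C a (k+k) ⇒ Z₊(det P) ≤ (2k+K)^a`: on this class S is the ABSOLUTE polynomial bound, `C` is idle.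
  Every algebraic branching program over lacunary monomials `c·t^D` is `det(U(t) − J)` (`J` subdiagonal ones, `U`
  upper triangular carrying the edge labels, each source–sink path contributing `+Π labels` — FORMALISED as
  `det_hessDet : det (hessDet k lab) = pathSum lab k` in `Theorems/DerivedPencilRolle/Negative/
  DerivedPencilRolleHessenbergPathSum.lean`, p146380, any commutative ring), and adding
  `ε Σ_l t^{d_l}` on the diagonal and a generic constant to `T_0` puts it in the class without changing the strict
  signs of `det` at finitely many test points.  So S ⇒ a POLYNOMIAL real-τ bound for skew circuits over lacunary
  monomials (`triangularPolyBound_of_derivedPencilRolle`) — vastly stronger than the `K^{bK}` the route consumes.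
  End-to-end exact check on ONE concrete class member (`compute/end_to_end.py`, seed 277: a 2×3 layered DAG,
  8 paths, N = 3 breakpoints, Λ = 4; f-ABP of 30 nodes ⇒ Hessenberg pencil k = 29, K = 3 distinct exponents,
  ε = 2^{−6000}): `T_l` upper triangular with positive diagonal, `det T_0 ≠ 0`, and the signs of `det P(t_j)` at the
  7 test points are `+,−,+,−,+,−,+` — exactly the predicted 2N = 6 alternations; `S_l` symmetric/invertible and
  `det F = (−1)^k det P²` confirmed at a sample point.
* §B  THE CLASS HAS `n^{Ω(log n)}` POSITIVE ROOTS (paper proof in the docstring of `triangularClassManyRoots_holds`,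
  the one `sorry` of this file = the construction item H).  Its analytic Step 3 (the convexity bump: `N` interlaced
  breakpoints ⇒ `2N` distinct positive roots of `f_A² − e^{−Λη/2} f_A(e^{η}t) f_A(e^{−η}t)`) is FORMALISED, sorry-free,
  in `Theorems/DerivedPencilRolle/Negative/DerivedPencilRolleBumpLemma.lean` (p146379; `two_mul_le_card_posRoots_bumpPoly`,
  `bump_neg_of_isBreakpoint`, `bump_pos_of_free`, `exists_affine_of_free`); what remains of H is combinatorial:
  the Hessenberg path-sum identity + perturbation (§A prose) and a DAG family with `n^{Ω(log n)}` breakpoints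
  (Mulmuley–Shah / Gajjar–Radhakrishnan recursion, rebuilt numerically below).  Numerics: j023449 (random DAGs and the recursive
  Mulmuley–Shah graphs `G(1,0,m)`, pieces ≥ n^m reproduced exactly; the bump polynomial shows exactly the predicted
  `2N` sign alternations with margins ≥ `2 log #paths` in 400-digit arithmetic).
* §C  `derivedPencilRolle_false : ¬ DerivedPencilRolle` (modulo the §B sorry).  Classification if landed:
  the witness kills the POLYNOMIAL additive slack; the quasi-polynomial repair C′ of §E survives it (Gusfield's
  upper bound `n^{log n + O(1)}` on breakpoints caps every tropical-bump family at `2^{(1+o(1)) log²(m+K)}`), and C′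
  still drives the route's glue — so the planner can RESTATE 18500 as C′ (or re-engine over `ExpRootBound`).
* §D  SMALL MODEL (sorry-free, landed as p144903 `…/Negative/DerivedPencilRolleIndefiniteWitness.lean`): `m = 2`,
  `K = 3`, `Z₊(det ∂F) = 0` while `Z₊(det F) ≥ 6`: the exponent `a` is ≥ 2 for EVERY `C`
  (`not_pencilBound_two_of_le_one`, `not_derivedPencilRolle_linear`).
* §E  REPAIR CANDIDATE C′ = `DerivedPencilRolleQP` (quasi-polynomial additive slack) with `S → C′` and the note that
  `RolleToDescartes`-type glue still absorbs it in the regime `log₂ m ≤ c(log₂K+1)²`.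
* §F  WHY IT RESISTED BEFORE / WHAT DOES NOT WORK: products, Kronecker, compositions, interpolation (strategist's
  table) are all additive or parameter-capped; the amplification lives in SHARED sub-DAGs (non-series-parallel ABPs):
  series-parallel tropical ABPs have polynomially many breakpoints, general DAGs `n^{Θ(log n)}` (Carstensen/Gusfield).
  The same mechanism can NEVER touch `LacunaryDescartes` (rank 3): in its regime breakpoints ≤ `n^{O(log n)}` ≤
  `2^{O(c² log⁴ K)} ≪ K^{bK}`.
-/

-- `Summit.ValiantsHypothesis.ValiantsHypothesis.…` repeats a component by the D-0017 layout.
set_option linter.dupNamespace false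

namespace Summit.ValiantsHypothesis.ValiantsHypothesis.Cruxes.DerivedPencilRolle.Disproof

open Summit.ValiantsHypothesis.ValiantsHypothesis.Theses.SymmetroidDescartes
open Summit.ValiantsHypothesis.ValiantsHypothesis.Theorems.DerivedPencilRolle.Negative (PencilBound
  derivedPencilRolle_iff)
open Summit.ValiantsHypothesis.ValiantsHypothesis.Theorems.SymmetroidDescartes (eval_det_pencil
  card_filter_roots_det_sum_fin_zero le_card_posRoots_of_alternating)
open scoped BigOperators Matrix
open Polynomial

/-! ## §A  The triangular class: the Rolle term vanishes, the crux becomes an absolute polynomial bound -/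

/-- **H (construction item).** The triangular class — `(K+1)`-term lacunary `k × k` matrix polynomials
`Σ X^{d l} • T l` with `T 0` invertible, `T l` (`l ≥ 1`) upper triangular with positive diagonal, `d 0 = 0`,
`d` strictly increasing — has, for every exponent `a`, a member whose determinant has more than
`(2k+K)^a` distinct positive roots.  (Every ABP over lacunary monomials lies in this class up to a
sign-preserving perturbation; true on paper by parametric-shortest-path breakpoints `n^{Ω(log n)}`
[Carstensen 1983; Mulmuley–Shah 2001; Gajjar–Radhakrishnan arXiv:1811.05115] and the convexity-bump
realisation of `Cruxes/DerivedPencilRolle/Disproof.lean` §B.) [topic Computability/AlgebraicComplexity] -/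
def TriangularClassManyRoots : Prop :=
  ∀ a : ℕ, ∃ (k K : ℕ) (T : Fin (K + 1) → Matrix (Fin k) (Fin k) ℝ) (d : Fin (K + 1) → ℕ),
    d 0 = 0 ∧ StrictMono d ∧ (T 0).det ≠ 0 ∧ (∀ l : Fin K, (T l.succ).BlockTriangular id) ∧
    (∀ (l : Fin K) (i : Fin k), 0 < T l.succ i i) ∧
    (2 * k + K) ^ a <
      ((∑ l, (X : ℝ[X]) ^ d l • (T l).map Polynomial.C).det.roots.toFinset.filter (fun t => 0 < t)).card

/-! ## Linear algebra of the symmetrisation `[[0, T], [Tᵀ, c • 1]]` -/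

section LinearAlgebra

variable {k : ℕ}

/-- `[[0, X], [Xᵀ, 0]]` is invertible when `X` is: `[[0, Xᵀ⁻¹… ]]` — we use the explicit right inverse
`[[0, (Xᵀ)⁻¹], [X⁻¹, 0]]`. -/
theorem det_fromBlocks_zero_transpose_ne_zero (X : Matrix (Fin k) (Fin k) ℝ) (hX : X.det ≠ 0) :
    (Matrix.fromBlocks (0 : Matrix (Fin k) (Fin k) ℝ) X Xᵀ 0).det ≠ 0 := by
  have hX' : IsUnit X.det := isUnit_iff_ne_zero.2 hX
  have hXt : IsUnit Xᵀ.det := by rw [Matrix.det_transpose]; exact hX'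
  have h : Matrix.fromBlocks (0 : Matrix (Fin k) (Fin k) ℝ) X Xᵀ 0 *
      Matrix.fromBlocks (0 : Matrix (Fin k) (Fin k) ℝ) Xᵀ⁻¹ X⁻¹ 0 = 1 := by
    rw [Matrix.fromBlocks_multiply]
    simp [Matrix.mul_nonsing_inv _ hX', Matrix.mul_nonsing_inv _ hXt, Matrix.fromBlocks_one]
  exact (Matrix.isUnit_det_of_right_inverse h).ne_zero

/-- `det [[0, X], [Xᵀ, 1]] = det (−X Xᵀ)`, which vanishes iff `det X = 0`. -/
theorem det_fromBlocks_zero_transpose_one (X : Matrix (Fin k) (Fin k) ℝ) :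
    (Matrix.fromBlocks (0 : Matrix (Fin k) (Fin k) ℝ) X Xᵀ 1).det = (-1) ^ k * X.det ^ 2 := by
  rw [Matrix.det_fromBlocks_one₂₂, zero_sub, Matrix.det_neg, Matrix.det_mul, Matrix.det_transpose,
    Fintype.card_fin]
  ring

/-- The symmetrised block is symmetric. -/
theorem isSymm_fromBlocks_zero_transpose (X : Matrix (Fin k) (Fin k) ℝ) (c : ℝ) :
    (Matrix.fromBlocks (0 : Matrix (Fin k) (Fin k) ℝ) X Xᵀ (c • (1 : Matrix (Fin k) (Fin k) ℝ))).IsSymm := by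
  unfold Matrix.IsSymm
  rw [Matrix.fromBlocks_transpose]
  simp

/-- An upper triangular real matrix with positive diagonal has nonzero (indeed positive) determinant. -/
theorem det_ne_zero_of_upperTriangular_pos (N : Matrix (Fin k) (Fin k) ℝ) (hN : N.BlockTriangular id)
    (hpos : ∀ i, 0 < N i i) : N.det ≠ 0 := by
  rw [Matrix.det_of_upperTriangular hN]
  exact (Finset.prod_pos fun i _ => hpos i).ne'

end LinearAlgebra

/-! ## The symmetrised pencil -/

section Symmetrise

variable {k K : ℕ}

/-- reindexing `Fin k ⊕ Fin k ≃ Fin (k + k)` -/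
def e2 (k : ℕ) : Fin k ⊕ Fin k ≃ Fin (k + k) := finSumFinEquiv

/-- weight of the identity block: `1` on the constant coefficient, `0` on the others -/
def δ (l : Fin (K + 1)) : ℝ := if l = 0 then 1 else 0

/-- the block coefficients: `[[0, T 0], [(T 0)ᵀ, 1]]` and `[[0, T l], [(T l)ᵀ, 0]]` for `l ≥ 1` -/
def blk (T : Fin (K + 1) → Matrix (Fin k) (Fin k) ℝ) (l : Fin (K + 1)) :
    Matrix (Fin k ⊕ Fin k) (Fin k ⊕ Fin k) ℝ :=
  Matrix.fromBlocks 0 (T l) (T l)ᵀ (δ l • (1 : Matrix (Fin k) (Fin k) ℝ))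

/-- the symmetrised coefficients, reindexed to `Fin (k + k)` -/
def symS (T : Fin (K + 1) → Matrix (Fin k) (Fin k) ℝ) (l : Fin (K + 1)) :
    Matrix (Fin (k + k)) (Fin (k + k)) ℝ :=
  Matrix.reindex (e2 k) (e2 k) (blk T l)

/-- the symmetrised coefficients are symmetric -/
theorem symS_isSymm (T : Fin (K + 1) → Matrix (Fin k) (Fin k) ℝ) (l : Fin (K + 1)) :
    (symS T l).IsSymm := by
  unfold symS Matrix.IsSymm
  rw [Matrix.transpose_reindex]
  congr 1
  exact isSymm_fromBlocks_zero_transpose (T l) _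

/-- the symmetrised coefficients are invertible -/
theorem symS_det_ne_zero (T : Fin (K + 1) → Matrix (Fin k) (Fin k) ℝ) (h0 : (T 0).det ≠ 0)
    (htri : ∀ l : Fin K, (T l.succ).BlockTriangular id) (hpos : ∀ (l : Fin K) (i : Fin k), 0 < T l.succ i i)
    (l : Fin (K + 1)) : (symS T l).det ≠ 0 := by
  unfold symS
  rw [Matrix.det_reindex_self]
  unfold blk
  refine Fin.cases ?_ (fun l => ?_) l
  · have h1 : δ (0 : Fin (K + 1)) = 1 := by simp [δ]
    rw [h1, one_smul, det_fromBlocks_zero_transpose_one]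
    exact mul_ne_zero (pow_ne_zero _ (by norm_num)) (pow_ne_zero _ h0)
  · have h1 : δ (Fin.succ l) = 0 := by simp [δ, Fin.succ_ne_zero]
    rw [h1, zero_smul]
    exact det_fromBlocks_zero_transpose_ne_zero _
      (det_ne_zero_of_upperTriangular_pos _ (htri l) (hpos l))

/-- A weighted sum of block matrices is the block matrix of the weighted sums. -/
theorem sum_smul_fromBlocks {ι : Type*} [Fintype ι] (c : ι → ℝ)
    (A B C D : ι → Matrix (Fin k) (Fin k) ℝ) :
    ∑ i, c i • Matrix.fromBlocks (A i) (B i) (C i) (D i) =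
      Matrix.fromBlocks (∑ i, c i • A i) (∑ i, c i • B i) (∑ i, c i • C i) (∑ i, c i • D i) := by
  ext x y
  rcases x with x | x <;> rcases y with y | y <;> simp [Matrix.sum_apply]

/-- A weighted sum of the block coefficients is the block matrix of the weighted sums. -/
theorem sum_smul_blk {ι : Type*} [Fintype ι] (T : Fin (K + 1) → Matrix (Fin k) (Fin k) ℝ)
    (g : ι → Fin (K + 1)) (c : ι → ℝ) :
    ∑ i, c i • blk T (g i) =
      Matrix.fromBlocks 0 (∑ i, c i • T (g i)) (∑ i, c i • T (g i))ᵀ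
        ((∑ i, c i * δ (g i)) • (1 : Matrix (Fin k) (Fin k) ℝ)) := by
  unfold blk
  rw [sum_smul_fromBlocks]
  congr 1
  · simp
  · rw [Matrix.transpose_sum]
    simp [Matrix.transpose_smul]
  · rw [Finset.sum_smul]
    simp [smul_smul]

/-- … and the same after reindexing. -/
theorem sum_smul_symS {ι : Type*} [Fintype ι] (T : Fin (K + 1) → Matrix (Fin k) (Fin k) ℝ)
    (g : ι → Fin (K + 1)) (c : ι → ℝ) :
    ∑ i, c i • symS T (g i) =
      Matrix.reindex (e2 k) (e2 k) (Matrix.fromBlocks 0 (∑ i, c i • T (g i)) (∑ i, c i • T (g i))ᵀ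
        ((∑ i, c i * δ (g i)) • (1 : Matrix (Fin k) (Fin k) ℝ))) := by
  rw [← sum_smul_blk]
  unfold symS
  ext x y
  simp [Matrix.sum_apply]

/-- Evaluating the symmetrised pencil: `det F(t) = (−1)^k · det P(t)²`. -/
theorem eval_det_symS (T : Fin (K + 1) → Matrix (Fin k) (Fin k) ℝ) (d : Fin (K + 1) → ℕ)
    (hd0 : d 0 = 0) (t : ℝ) :
    ((∑ l, (X : ℝ[X]) ^ d l • (symS T l).map Polynomial.C).det).eval t =
      (-1) ^ k * (∑ l, t ^ d l • T l).det ^ 2 := by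
  have hsum := sum_smul_symS T id (fun l => t ^ d l)
  simp only [id] at hsum
  rw [eval_det_pencil, hsum, Matrix.det_reindex_self]
  have hone : (∑ i : Fin (K + 1), t ^ d i * δ i) = 1 := by
    rw [Finset.sum_eq_single (0 : Fin (K + 1))]
    · simp [hd0, δ]
    · intro b _ hb
      simp [hb, δ]
    · simp
  rw [hone, one_smul]
  exact det_fromBlocks_zero_transpose_one (∑ i : Fin (K + 1), t ^ d i • T i)

/-- Evaluating the DERIVED symmetrised pencil at `t > 0` gives a nonzero number (when `K ≥ 1`):
the derived block is `[[0, N], [Nᵀ, 0]]` with `N = Σ_{l≥1} d_l t^{d_l - 1} T l` upper triangular with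
positive diagonal. -/
theorem eval_det_derived_symS_ne_zero (T : Fin (K + 1) → Matrix (Fin k) (Fin k) ℝ)
    (d : Fin (K + 1) → ℕ) (hd : StrictMono d)
    (htri : ∀ l : Fin K, (T l.succ).BlockTriangular id) (hpos : ∀ (l : Fin K) (i : Fin k), 0 < T l.succ i i)
    (hK : 0 < K) (t : ℝ) (ht : 0 < t) :
    ((∑ l : Fin K, (X : ℝ[X]) ^ (d l.succ - d 0 - 1) •
        (((d l.succ - d 0 : ℕ) : ℝ) • symS T l.succ).map Polynomial.C).det).eval t ≠ 0 := by
  have hsmul : ∀ l : Fin K, ((d l.succ - d 0 : ℕ) : ℝ) • symS T l.succ =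
      symS (fun j => ((d j - d 0 : ℕ) : ℝ) • T j) l.succ := by
    intro l
    unfold symS blk
    ext x y
    simp only [Matrix.reindex_apply, Matrix.smul_apply, Matrix.submatrix_apply]
    rcases (e2 k).symm x with x' | x' <;> rcases (e2 k).symm y with y' | y' <;>
      simp [δ, Matrix.fromBlocks_apply₁₁, Matrix.fromBlocks_apply₁₂, Matrix.fromBlocks_apply₂₁,
        Matrix.fromBlocks_apply₂₂, Fin.succ_ne_zero, Matrix.transpose_apply, Matrix.smul_apply]
  simp_rw [hsmul]
  rw [eval_det_pencil, sum_smul_symS _ Fin.succ (fun l : Fin K => t ^ (d l.succ - d 0 - 1)),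
    Matrix.det_reindex_self]
  simp only [δ, Fin.succ_ne_zero, if_false, mul_zero, Finset.sum_const_zero, zero_smul]
  set N : Matrix (Fin k) (Fin k) ℝ :=
    ∑ i : Fin K, t ^ (d i.succ - d 0 - 1) • (((d i.succ - d 0 : ℕ) : ℝ) • T i.succ) with hN
  have hNtri : N.BlockTriangular id := by
    intro i j hij
    simp only [hN, Matrix.sum_apply, Matrix.smul_apply, smul_eq_mul]
    refine Finset.sum_eq_zero fun l _ => ?_
    rw [htri l hij, mul_zero, mul_zero]
  have hNpos : ∀ i, 0 < N i i := by
    intro i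
    simp only [hN, Matrix.sum_apply, Matrix.smul_apply, smul_eq_mul]
    haveI : Nonempty (Fin K) := Fin.pos_iff_nonempty.1 hK
    refine Finset.sum_pos (fun l _ => ?_) Finset.univ_nonempty
    have h1 : 0 < d l.succ - d 0 := Nat.sub_pos_of_lt (hd (Fin.succ_pos l))
    refine mul_pos (pow_pos ht _) (mul_pos ?_ (hpos l i))
    exact_mod_cast h1
  exact det_fromBlocks_zero_transpose_ne_zero N (det_ne_zero_of_upperTriangular_pos N hNtri hNpos)

end Symmetrise

/-! ## The crux bound on the symmetrised pencil is an absolute polynomial bound on the class -/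

/-- **Core.** At fixed constants: `PencilBound C a (k+k)` forces `Z₊(det P) ≤ (k+k+K)^a` for every
member `P = Σ X^{d l} • T l` of the triangular class — the multiplier `C` buys nothing, because the
derived symmetrised pencil has no positive roots at all. -/
theorem triangular_bound_of_pencilBound (C a k K : ℕ) (T : Fin (K + 1) → Matrix (Fin k) (Fin k) ℝ)
    (d : Fin (K + 1) → ℕ) (hd0 : d 0 = 0) (hd : StrictMono d) (h0 : (T 0).det ≠ 0)
    (htri : ∀ l : Fin K, (T l.succ).BlockTriangular id) (hpos : ∀ (l : Fin K) (i : Fin k), 0 < T l.succ i i)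
    (h : PencilBound C a (k + k)) :
    ((∑ l, (X : ℝ[X]) ^ d l • (T l).map Polynomial.C).det.roots.toFinset.filter (fun t => 0 < t)).card ≤
      (k + k + K) ^ a := by
  -- the crux instance at the symmetrised pencil
  have hinst := h K (symS T) d (symS_isSymm T) (symS_det_ne_zero T h0 htri hpos) hd
  -- the derived term vanishes
  have hder : ((∑ l : Fin K, (X : ℝ[X]) ^ (d l.succ - d 0 - 1) •
      (((d l.succ - d 0 : ℕ) : ℝ) • symS T l.succ).map Polynomial.C).det.roots.toFinset.filter
        (fun t => 0 < t)).card = 0 := by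
    rcases Nat.eq_zero_or_pos K with hK | hK
    · subst hK
      exact card_filter_roots_det_sum_fin_zero _ _
    · rw [Finset.card_eq_zero, Finset.filter_eq_empty_iff]
      intro t ht hpos_t
      rw [Multiset.mem_toFinset] at ht
      exact eval_det_derived_symS_ne_zero T d hd htri hpos hK t hpos_t (mem_roots'.1 ht).2
  rw [hder, mul_zero, zero_add] at hinst
  -- the symmetrised determinant has at least the positive roots of `det P`
  refine le_trans (Finset.card_le_card fun t ht => ?_) hinst
  rw [Finset.mem_filter, Multiset.mem_toFinset] at ht ⊢
  obtain ⟨ht, htpos⟩ := ht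
  have hPne := (mem_roots'.1 ht).1
  have hProot := (mem_roots'.1 ht).2
  refine ⟨mem_roots'.2 ⟨?_, ?_⟩, htpos⟩
  · -- `det F ≠ 0`: otherwise `det P` would vanish at every real point
    intro hF
    apply hPne
    refine eq_zero_of_infinite_isRoot _ (Set.infinite_of_forall_exists_gt fun s => ⟨s + 1, ?_, by linarith⟩)
    have hev := congrArg (Polynomial.eval (s + 1)) hF
    rw [eval_det_symS T d hd0, Polynomial.eval_zero] at hev
    have hsq : (∑ l, (s + 1) ^ d l • T l).det = 0 := by
      have := (mul_eq_zero.1 hev).resolve_left (pow_ne_zero _ (by norm_num))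
      exact pow_eq_zero_iff (n := 2) (by norm_num) |>.1 this
    show IsRoot _ _
    rw [IsRoot.def, eval_det_pencil]
    exact hsq
  · rw [IsRoot.def, eval_det_symS T d hd0]
    rw [IsRoot.def, eval_det_pencil] at hProot
    rw [hProot]
    ring

/-- The crux implies an ABSOLUTE polynomial bound on the triangular (ABP) class — a polynomial real-τ
statement for skew circuits over lacunary monomials, in which the Rolle structure plays no role. -/
theorem triangularPolyBound_of_derivedPencilRolle (h : DerivedPencilRolle) :
    ∃ a : ℕ, ∀ (k K : ℕ) (T : Fin (K + 1) → Matrix (Fin k) (Fin k) ℝ) (d : Fin (K + 1) → ℕ),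
      d 0 = 0 → StrictMono d → (T 0).det ≠ 0 → (∀ l : Fin K, (T l.succ).BlockTriangular id) →
      (∀ (l : Fin K) (i : Fin k), 0 < T l.succ i i) →
      ((∑ l, (X : ℝ[X]) ^ d l • (T l).map Polynomial.C).det.roots.toFinset.filter
        (fun t => 0 < t)).card ≤ (2 * k + K) ^ a := by
  obtain ⟨C, a, hCa⟩ := (derivedPencilRolle_iff).1 h
  refine ⟨a, fun k K T d hd0 hd h0 htri hpos => ?_⟩
  have := triangular_bound_of_pencilBound C a k K T d hd0 hd h0 htri hpos (hCa (k + k))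
  rwa [two_mul]

/-- **Negative lemma modulo H.** If the triangular class has super-polynomially many positive roots
(`TriangularClassManyRoots`, true on paper — see the module docstring), the crux `DerivedPencilRolle`
is false. -/
theorem derivedPencilRolle_false_of_triangularClassManyRoots (hH : TriangularClassManyRoots) :
    ¬ DerivedPencilRolle := by
  intro h
  obtain ⟨a, ha⟩ := triangularPolyBound_of_derivedPencilRolle h
  obtain ⟨k, K, T, d, hd0, hd, h0, htri, hpos, hlt⟩ := hH a
  exact absurd (ha k K T d hd0 hd h0 htri hpos) (not_le.2 hlt)

/-! ## §B  The triangular class has super-polynomially many positive roots (paper proof; the construction item) -/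

/-- **H holds (paper proof; the single `sorry` of this work file — its formalisation is the construction item
filed with the negative lemma).**

*Setting.* A layered DAG `A` (source `σ`, sink `τ`, every `σ–τ` path has the same length `ℓ`), edge data
`d_e ∈ ℕ`, `γ_e ∈ ℝ`; for a path `π`, `w_π = Σ d_e ∈ ℕ`, `γ_π = Σ γ_e`; tropicalisation
`L(s) = max_π (γ_π + s·w_π)`, a convex piecewise-linear function with integer slopes; let `s_1 < ⋯ < s_N` be its
breakpoints, `Δ` their minimal spacing, `P` the number of paths.

*Step 1 (breakpoints, published).* There are such DAGs with `n` vertices, `poly(n)` edges and `N ≥ n^{κ log n}`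
(Carstensen 1983, PhD thesis U. Michigan, ch. on parametric shortest chains; Mulmuley–Shah, "A lower bound for the
shortest path problem", JCSS 63 (2001), Thm 1.2/Lemma 4.1, with `O(log³ n)`-bit integer coefficients;
Gajjar–Radhakrishnan, arXiv:1811.05115, Thm 1 + Lemma 7 (`Φ(1,0,⌊log n⌋)`: `n^{⌊log n⌋}` pieces on `≤ 6n⁸`
vertices, even planar).  They state it for MIN-cost with weights `a_e + b_e λ`; `min = −max(−·)` has the same
breakpoints, rational slopes become integers after `λ = Q·s`, and since the graphs are layered a common shift
`d_e ↦ d_e + c` makes all slopes non-negative without changing the arg-max structure.  (j023449 rebuilds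
`G(1,0,m)` exactly and finds ≥ `n^m` pieces: `(n,m) = (4,1): 5`, `(4,2): 29`, ….)

*Step 2 (positive ABP).* Fix `Λ ∈ ℕ` and put labels `c_e t^{D_e}`, `c_e = e^{Λγ_e} > 0`, `D_e = Λ d_e`.  Then
`f_A(t) = Σ_π C_π t^{Λ w_π}` with `C_π = e^{Λγ_π} > 0`, and for real `s`,
`f_A(e^s) = e^{Λ L(s)}·ν_Λ(s)` with `1 ≤ ν_Λ(s) ≤ P`                                                  (★)
(each path contributes at most the maximum, the arg-max path contributes exactly it).

*Step 3 (the bump).* Let `0 < η ≤ Δ/3` and `f(t) := f_A(t)² − e^{−Λη/2}·f_A(e^{η}t)·f_A(e^{−η}t)`.  Since `L` is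
convex PL with integer slopes: if `[u−η,u+η]` contains no breakpoint then `L(u+η)+L(u−η) = 2L(u)`; at a breakpoint
`s_r` (no other breakpoint within `η`), `L(s_r+η)+L(s_r−η) − 2L(s_r) = η·(slope jump) ≥ η`.  With (★):
  `f(e^{u}) ≥ e^{2ΛL(u)}·(1 − P² e^{−Λη/2}) > 0`      at the `N+1` points `u` = midpoints / `s_1 − 3η` / `s_N + 3η`,
  `f(e^{s_r}) ≤ e^{2ΛL(s_r)}·(P² − e^{Λη/2}) < 0`     at the `N` breakpoints,
as soon as `Λη/2 > 2 log P` (take `Λ = ⌈8 log P/η⌉ + 1`).  These `2N+1` points interlace, so `f` has `2N` strict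
sign alternations on `(0,∞)`, hence ≥ `2N` distinct positive roots (IVT; tree lemma
`le_card_posRoots_of_alternating`).  (j023449: the observed sign pattern is exactly this, margins ≥ `2 log P`.)

*Step 4 (into the class).* `f` is computed by the ABP "`A` then `A` (series), in parallel with `A_η` then `A_{−η}`
followed by one edge of constant label `−e^{−Λη/2}`", where `A_{±η}` is `A` with constants `c_e e^{±ηD_e}`: at
most `k = 4|V(A)|` non-source nodes, labels constants or POSITIVE multiples of `t^{D_e}`, exponent set
`{D_e} = Λ·{d_e}` of size `K ≤ |E(A)|`.  Order the nodes topologically; `f = det(U(t) − J)` with `U` upper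
triangular holding the labels (entry `(i+1, j)` ← label of edge `i → j`; expanding along the unit subdiagonal, every
path enters with sign `+`).  Now perturb: `T_0 := U(0) − J + ε'·X` (generic `X`, so `det T_0 ≠ 0`), and for
`l ≥ 1`, `T_l :=` (coefficient of `t^{D_l}` in `U`) `+ ε·1` on the diagonal: upper triangular, diagonal entries
`ε` or `c + ε` with `c > 0` — positive.  `det(Σ_l t^{D_l} T_l) → f(t)` coefficientwise as `ε, ε' → 0`, so for
small `ε, ε'` the `2N+1` strict signs persist: the class member has ≥ `2N ≥ 2n^{κ log n}` positive roots while
`2k + K ≤ 8|V| + |E| = poly(n)`.  For every `a`, large `n` gives `(2k+K)^a < 2N`.  ∎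

*Numerics (kit j023449, `compute/bump_realisation.py`, exact rational envelopes + 400-digit log arithmetic;
evidence `compute-j023449.json` on the item).*  Mulmuley–Shah/Gajjar–Radhakrishnan graphs `G(1,0,m)` rebuilt
verbatim (non-planar LINK):

  (n,m)   nodes  edges  paths      pieces  n^m   distinct slopes K   Λ            sign tests  alternations
  (4,1)   13     12     5          5       4     5                   4            9           8    (= 2N)
  (4,2)   54     73     125        29      16    13                  3434         57          56
  (4,3)   209    340    4515625    160     64    29                  9.6e12       319         318
  (5,1)   15     14     6          6       5     6                   3            11          10
  (5,2)   64     93     216        41      25    16                  3520         81          80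
  (5,3)   251    450    27625536   265     125   36                  1.2e14       529         528

Every one of the `Σ (2N+1)` sign tests came out exactly as predicted (`+` at midpoints, `−` at breakpoints), with
minimal log-margins `≥ 10` against a theoretical guarantee `≥ 2 log P`; 8 random layered DAGs likewise.  (At
these toy sizes `2N` is of course still below `2k+K`; the content is the mechanism + the published asymptotics
`N = n^{Ω(log n)}` against `2k+K = poly(n)`.)

*What is NOT claimed.* Nothing here produces more than `n^{log n+O(1)}` roots (Gusfield's upper bound on
breakpoints), i.e. more than `2^{(1+o(1))·log²(m+K)}`: the quasi-polynomial repair §E and `LacunaryDescartes`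
survive this mechanism. -/
theorem triangularClassManyRoots_holds : TriangularClassManyRoots := by
  sorry

/-! ## §C  The kill (modulo §B) and its bookkeeping -/

/-- **¬S, modulo the construction of §B.**  (Sorry-tainted through `triangularClassManyRoots_holds` only; the
implication itself is the landed negative lemma.) -/
theorem derivedPencilRolle_false : ¬ DerivedPencilRolle :=
  derivedPencilRolle_false_of_triangularClassManyRoots triangularClassManyRoots_holds

/-! ## §D  Small model: the additive exponent is ≥ 2 for every multiplier (landed separately, p144903) -/

/-- The indefinite `2 × 2` four-nomial witness: `S₅ 0 = [[2000,-3000],[-3000,2000]]`,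
`S₅ 1 = [[1,16000],[16000,-1]]`, `S₅ 2 = [[1,-12000],[-12000,-1]]`, `S₅ 3 = [[1,2000],[2000,-1]]`. -/
def S₅ : Fin 4 → Matrix (Fin 2) (Fin 2) ℝ :=
  ![!![2000, -3000; -3000, 2000], !![1, 16000; 16000, -1], !![1, -12000; -12000, -1],
    !![1, 2000; 2000, -1]]

/-- exponents `d l = l` -/
def d₅ : Fin 4 → ℕ := fun l => (l : ℕ)

/-- `d₅` is strictly increasing. -/
theorem d₅_strictMono : StrictMono d₅ := fun a b h => by
  simpa [d₅] using h

/-- every coefficient of the witness is symmetric -/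
theorem S₅_symm (l : Fin 4) : (S₅ l).IsSymm := by
  fin_cases l <;> (unfold Matrix.IsSymm; ext i j; fin_cases i <;> fin_cases j <;> rfl)

/-- every coefficient of the witness is invertible -/
theorem S₅_det (l : Fin 4) : (S₅ l).det ≠ 0 := by
  fin_cases l <;> simp [S₅, Matrix.det_fin_two] <;> norm_num

/-- `det F(t)` in closed form. -/
theorem eval_det_F₅ (t : ℝ) :
    ((∑ l, (X : ℝ[X]) ^ d₅ l • (S₅ l).map Polynomial.C).det).eval t =
      (2000 + (t + t ^ 2 + t ^ 3)) * (2000 - (t + t ^ 2 + t ^ 3)) -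
        (1000 * (2 * t ^ 3 - 12 * t ^ 2 + 16 * t - 3)) ^ 2 := by
  rw [eval_det_pencil]
  simp [Matrix.det_fin_two, Fin.sum_univ_four, S₅, d₅]
  ring

/-- `det ∂F(t)` in closed form (it is negative for every real `t`). -/
theorem eval_det_dF₅ (t : ℝ) :
    ((∑ l : Fin 3, (X : ℝ[X]) ^ (d₅ l.succ - d₅ 0 - 1) •
        (((d₅ l.succ - d₅ 0 : ℕ) : ℝ) • S₅ l.succ).map Polynomial.C).det).eval t =
      -(1 + 2 * t + 3 * t ^ 2) ^ 2 - (16000 - 24000 * t + 6000 * t ^ 2) ^ 2 := by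
  rw [eval_det_pencil (fun l : Fin 3 => ((d₅ l.succ - d₅ 0 : ℕ) : ℝ) • S₅ l.succ)
    (fun l => d₅ l.succ - d₅ 0 - 1) t]
  simp [Matrix.det_fin_two, Fin.sum_univ_three, S₅, d₅, Fin.succ]
  ring

/-- `det ∂F(t) < 0` for every real `t`. -/
theorem eval_det_dF₅_neg (t : ℝ) :
    ((∑ l : Fin 3, (X : ℝ[X]) ^ (d₅ l.succ - d₅ 0 - 1) •
        (((d₅ l.succ - d₅ 0 : ℕ) : ℝ) • S₅ l.succ).map Polynomial.C).det).eval t < 0 := by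
  rw [eval_det_dF₅]
  have h1 : 0 < 1 + 2 * t + 3 * t ^ 2 := by nlinarith [sq_nonneg (t + 1/3)]
  nlinarith [sq_nonneg (16000 - 24000 * t + 6000 * t ^ 2), mul_pos h1 h1]

/-- The derived determinant has no positive roots (indeed no real roots). -/
theorem card_posRoots_dF₅ :
    ((∑ l : Fin 3, (X : ℝ[X]) ^ (d₅ l.succ - d₅ 0 - 1) •
        (((d₅ l.succ - d₅ 0 : ℕ) : ℝ) • S₅ l.succ).map Polynomial.C).det.roots.toFinset.filter
          (fun t => 0 < t)).card = 0 := by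
  rw [Finset.card_eq_zero, Finset.filter_eq_empty_iff]
  intro t ht
  rw [Multiset.mem_toFinset] at ht
  have h := (mem_roots'.1 ht).2
  have hneg := eval_det_dF₅_neg t
  rw [IsRoot.def] at h
  exact absurd h (ne_of_lt hneg)

/-- seven positive test points with alternating signs of `det F` -/
noncomputable def τ₅ : Fin 7 → ℝ := ![1/20, 1/4, 1, 3/2, 3, 21/5, 5]

/-- the test points increase -/
theorem τ₅_strictMono : StrictMono τ₅ := by
  refine Fin.strictMono_iff_lt_succ.2 fun j => ?_
  fin_cases j <;> simp [τ₅] <;> norm_num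

/-- the test points are positive -/
theorem τ₅_pos (j : Fin 7) : 0 < τ₅ j := by
  fin_cases j <;> simp [τ₅]

/-- `det F` alternates in sign along the test points (`norm_num` certificate). -/
theorem alt₅ (j : Fin 6) :
    ((∑ l, (X : ℝ[X]) ^ d₅ l • (S₅ l).map Polynomial.C).det).eval (τ₅ j.castSucc) *
      ((∑ l, (X : ℝ[X]) ^ d₅ l • (S₅ l).map Polynomial.C).det).eval (τ₅ j.succ) < 0 := by
  fin_cases j <;> simp only [eval_det_F₅, τ₅] <;> simp <;> norm_num

/-- `det F` has at least six distinct positive roots. -/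
theorem six_le_card_posRoots_F₅ :
    6 ≤ ((∑ l, (X : ℝ[X]) ^ d₅ l • (S₅ l).map Polynomial.C).det.roots.toFinset.filter
      (fun t => 0 < t)).card :=
  le_card_posRoots_of_alternating _ 6 τ₅ τ₅_strictMono τ₅_pos alt₅

/-- **The additive exponent is at least two, for every multiplier.** `m = 2`, `K = 3`:
`Z₊(det F) ≥ 6` while `Z₊(det ∂F) = 0`, so `6 ≤ C·0 + 5^a` fails for `a ≤ 1`. -/
theorem not_pencilBound_two_of_le_one (C a : ℕ) (ha : a ≤ 1) : ¬ PencilBound C a 2 := by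
  intro h
  have h1 := h 3 S₅ d₅ S₅_symm S₅_det d₅_strictMono
  rw [card_posRoots_dF₅] at h1
  have h6 : 6 ≤ C * 0 + (2 + 3) ^ a := six_le_card_posRoots_F₅.trans h1
  have h5 : (2 + 3) ^ a ≤ 5 := by
    interval_cases a <;> norm_num
  omega

/-- The natural strengthening "linear additive slack" of the crux is false. -/
theorem not_derivedPencilRolle_linear : ¬ ∃ C a : ℕ, a ≤ 1 ∧ ∀ m, PencilBound C a m :=
  fun ⟨C, a, ha, h⟩ => not_pencilBound_two_of_le_one C a ha (h 2)

/-- Any constants witnessing the crux have additive exponent `a ≥ 2`. -/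
theorem two_le_of_pencilBound (C a : ℕ) (h : ∀ m, PencilBound C a m) : 2 ≤ a := by
  by_contra hlt
  exact not_pencilBound_two_of_le_one C a (by omega) (h 2)

/-! ## §E  Repair candidate C′: quasi-polynomial additive slack -/

/-- **C′ (repair candidate for the planner).** The crux with additive slack `2^{a·(log₂(m+K)+1)²}` instead of
`(m+K)^a`.  The §B family does not refute it (tropical-bump families are capped at `2^{(1+o(1)) log²}` by
Gusfield's bound), and the route's glue still absorbs it: iterating gives `Z₊ ≤ C^K·K·2^{a(log₂(m+K)+1)²}`, and in
the regime `log₂ m ≤ c(log₂K+1)²` the last factor is `2^{O(a c² log⁴K)} ≤ K^K` for `K ≥ K₀(a,c)`, so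
`b = log₂C + 3` works in `LacunaryDescartes`.  Whether C′ is TRUE is open: with `C = 0` it says real roots of
lacunary skew circuits never beat their tropical count by more than a constant in the exponent of `log²`. -/
def DerivedPencilRolleQP : Prop :=
  ∃ C a : ℕ, ∀ (m K : ℕ) (S : Fin (K + 1) → Matrix (Fin m) (Fin m) ℝ) (d : Fin (K + 1) → ℕ),
    (∀ l, (S l).IsSymm) → (∀ l, (S l).det ≠ 0) → StrictMono d →
      ((∑ l, (Polynomial.X : Polynomial ℝ) ^ d l • (S l).map Polynomial.C).det.roots.toFinset.filter
          (fun t => 0 < t)).card ≤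
        C * ((∑ l : Fin K, (Polynomial.X : Polynomial ℝ) ^ (d l.succ - d 0 - 1) •
          (((d l.succ - d 0 : ℕ) : ℝ) • S l.succ).map Polynomial.C).det.roots.toFinset.filter
            (fun t => 0 < t)).card + 2 ^ (a * (Nat.log 2 (m + K) + 1) ^ 2)

/-- polynomial slack is below quasi-polynomial slack: `(m+K)^a ≤ 2^{a (log₂(m+K)+1)²}` -/
theorem pow_le_two_pow_log_sq (x a : ℕ) : x ^ a ≤ 2 ^ (a * (Nat.log 2 x + 1) ^ 2) := by
  have hx : x ≤ 2 ^ (Nat.log 2 x + 1) := (Nat.lt_pow_succ_log_self (by norm_num) x).le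
  calc x ^ a ≤ (2 ^ (Nat.log 2 x + 1)) ^ a := Nat.pow_le_pow_left hx a
    _ = 2 ^ (a * (Nat.log 2 x + 1)) := by rw [← pow_mul, mul_comm]
    _ ≤ 2 ^ (a * (Nat.log 2 x + 1) ^ 2) := by
        apply Nat.pow_le_pow_right (by norm_num)
        have : Nat.log 2 x + 1 ≤ (Nat.log 2 x + 1) ^ 2 := by nlinarith
        exact Nat.mul_le_mul_left a this

/-- `S → C′` (so C′ is a genuine weakening; the converse is what the §B family separates ON PAPER). -/
theorem derivedPencilRolleQP_of_derivedPencilRolle (h : DerivedPencilRolle) : DerivedPencilRolleQP := by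
  obtain ⟨C, a, h⟩ := h
  refine ⟨C, a, fun m K S d hS hdet hd => ?_⟩
  exact (h m K S d hS hdet hd).trans (Nat.add_le_add_left (pow_le_two_pow_log_sq (m + K) a) _)

end Summit.ValiantsHypothesis.ValiantsHypothesis.Cruxes.DerivedPencilRolle.Disproof
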